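import Literature.NumberTheory.EllipticCurves.Rank1Residual.Typed.X9
import Literature.NumberTheory.EllipticCurves.MatarNekovar2019.ShaVanishing
import HarnessLib

/-!
# Classes X9 / X10b: the Heegner-index certificate at a NON-surjective IRREDUCIBLE prime through
# Matar–Nekovář 2019 Thm. 6.7 (1) — the Cha-2005-free twin of `X9ChaCertificate.lean`

HONEST FRAMING (cell `b2b-bsdres`, run/shared/lean/b2b/bsd-rank1-residual/, verbatim in every
file): the goal of the cell is to DELETE the COMBINATION-SHAPED residual classes of the
Birch–Swinnerton-Dyer formula for ALL analytic-rank `≤ 1` elliptic curves over `ℚ` — "full BSD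
formula for every rank `≤ 1` curve in class `C`" assembled STRICTLY from published theorems — so
that the rank-`≤ 1` remainder becomes exactly the CONSTRUCTION-SHAPED classes, which are TYPED
(missing-input `Prop`s), NOT attempted. This is not "finishing BSD". X9 and X10b REMAIN
CONSTRUCTION-SHAPED; nothing here is a class theorem; nothing is booked by this file.

Literature seat of the `pub-bsdpct` bundle (unit `pub-bsdpct-1`, gen 87). Theorems only: pure
compositions of tree theorems BY NAME; no definition, no new named fact (D-0026).

## Why this file exists

`Rank1Residual/X9ChaCertificate.lean` (cell x9, gen 6) closes an X9 pair `(E, p)` — good ordinary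
`p ≥ 5`, `E[p]` irreducible, `ρ̄_{E,p}` NOT surjective — from a Heegner-index certificate through the
named fact `Cha2005.thm52_padicValNat_shaOrder_le` (Cha, J. Number Theory 111 (2005) = Miller, LMS
J. Comput. Math. 14 (2011) Thm. 5.2 = GJPST, Math. Comp. 78 (2009) Thm. 3.5). The primary source of
that fact is NOT held (acquisition request acq-08222, Elsevier; the hub's fetchers are refused), so
it travels with the flag `Cha05-primary-unread`, and the bundle's referee reads that flag as
tier-affecting for the RESIDUAL-CASES records that name this consumer (REFEREE.md R148.1, R170.3
reading (β): the nine X9 records of block (d23) and `10082b1 @ 3` of (d25) sit in the FLAGGED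
column until "the primary page-check of Thm 5.2 lands").

The SAME certificate closes the SAME pairs through a refereed source that IS held and read:
A. Matar, J. Nekovář, *Kolyvagin's result on the vanishing of `Ш(E/K)[p^∞]` and its consequences for
anticyclotomic Iwasawa theory*, J. Théor. Nombres Bordeaux 31 (2019) 455–501, **Thm. 6.7 (1)**
(p. 498; tree fact `MatarNekovar2019.thm67_sha_primary_trivial_of_irreducible`,
`MatarNekovar2019/ShaVanishing.lean`; its §6.6 says it "reproves (and slightly extends)" Cha 2005
Thm. 21 for `m = 0`): for `p ≠ 2`, `E[p]` an IRREDUCIBLE `𝔽_p[G_ℚ]`-module, `K` a Heegner field for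
`N`, `(K, p) ≠ (ℚ(√−3), 3)` and `y_K ∉ pE(K)`: `Ш(E/K)[p^∞] = 0`; whence `Ш(E/ℚ)[p] = 0`
(`Typed.noPTorsion_of_matarNekovar_of_not_dvd_index`, restriction being injective on the `p`-part
for odd `p`) and Miller's `BSD(E,p)` at a pair with `ord_p #Ш_an = 0`
(`Typed.bsdp_of_matarNekovar_of_not_dvd_index`). Its hypotheses are a SUBSET of the Cha route's:

| binder of `X9.bsdp_of_cha_of_not_dvd_index`      | needed by Matar–Nekovář Thm. 6.7 (1)?            |
|---------------------------------------------------|--------------------------------------------------|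
| `¬ W.HasCM` (from `ClassX9`)                      | no                                               |
| `5 ≤ p` (from `ClassX9`; gives `p ≠ 2`)           | only `p ≠ 2`                                     |
| `Irr W p` (from `ClassX9`)                        | yes (`W.HasIrreducibleModPGaloisRep p`)          |
| `hpD : ¬ p ∣ d_K`                                 | no (at `p = 3` it would give `d_K ≠ −3`)         |
| `hpN : ¬ p² ∣ N`                                  | no                                               |
| Heegner field `K` for `N`, Heegner point `P`      | yes, same data                                   |
| `¬ IsOfFinAddOrder P`, `p ∤ [E(K) : ℤP]`          | yes, same certificate                            |
| `r_an ≤ 1`, `#Ш_an = q`, `ord_p q = 0`            | yes, same certificate                            |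

So every Cha-route closure of an X9 pair (`p ≥ 5`, where the proviso `(K,p) ≠ (ℚ(√−3),3)` is
vacuous) is, with the certificate ALREADY on file, a Matar–Nekovář closure; and at `p = 3` (X10b,
the shadow class `ClassX10 W 3 ∧ ¬ Surj W 3`) the Cha binder `3 ∤ d_K` implies the proviso
`d_K ≠ −3` (`discr_ne_neg_three_of_not_three_dvd`). The certificate lane records the same
inclusion for its rows (bsdN/HYPOTHESES.md, ORDER v5: "T-MN19's hypotheses are implied by T-KOLY's
and T-CHA's at p odd"), and the bundle's referee adopted T-MN19 as a flag-free row at irreducible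
`p` (REFEREE.md R178.3 (ii)). The companion consumers for the supersingular classes X6/X7/X8 are
`Summit.BirchSwinnertonDyer.Rank1Residual.Supersingular.X7.bsdp_of_matarNekovar_of_not_dvd_index`
etc. (`Summits/…/Supersingular/HeegnerIndexRoute.lean`, harvest seat gen 13); this file supplies
the missing X9 / X10b ones, in the exact binder shape of the Cha consumers minus `hpD`, `hpN`
(and minus `¬cm`, which the class predicate carries anyway).

NOT covered here (different shape): the X10b RESISTANT list with `ord_3 #Ш_an = 2`
(`Typed/X10bHeegnerIndexCertificate.lean`: Cha's BOUND `ord_3 #Ш(E/ℚ) ≤ 2·ord_3 [E(K) : ℤ y_K]`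
with an index certificate `≤ 1`, a `3`-descent lower bound and Cassels–Tate); its Cha-free twin
needs the INDEX BOUND over `K` (Matar–Nekovář Thm. 0.3, tree fact
`MatarNekovar2019.thm03_padicValNat_card_sha_le_of_irreducible`, `d_K ∉ {−3, −4}`) plus the
odd-part comparison `#Ш(E/K)[p^∞] = #Ш(E/ℚ)[p^∞] · #Ш(E^{d_K}/ℚ)[p^∞]`
(`WeierstrassCurve.card_primaryComponent_sha_baseChange_quadratic_of_odd_of_finite`), not the
vanishing theorem used below.

References: Matar–Nekovář 2019 Thm. 6.7 (1), Prop. 5.26, Prop. 6.4–6.5, §6.6 [MatarNekovar2019];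
Miller 2011 Thm. 5.2, §1 Def. 1.1 [Miller2011LMS]; GJPST 2009 Thm. 3.5 and Rem. 3.6
[GrigorovJorzaPatrikisSteinTarnita2009]; RESIDUAL-CASES.md §a.2 rows X9 / X10, blocks (d23), (d25);
REFEREE.md R148.1, R165.2, R170.3, R171.3, R178.3, R191.3.
-/

noncomputable section

open scoped Classical

open WeierstrassCurve Literature.NumberTheory.EllipticCurves
  Literature.NumberTheory.EllipticCurves.Rank1Residual

namespace Literature.NumberTheory.EllipticCurves.Rank1Residual.Typed

/-! ### The one arithmetic remark: Cha's `p ∤ d_K` at `p = 3` gives Matar–Nekovář's proviso -/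

/-- If `3 ∤ d_K` then `d_K ≠ −3`: at `p = 3` the Cha-route binder `p ∤ d_K` implies the proviso
`(K, 3) ≠ (ℚ(√−3), 3)` of Matar–Nekovář Thm. 6.7 (1) in the tree's form `p = 3 → d_K ≠ −3`.
[cite: MatarNekovar2019, Thm. 6.7 (1) (p. 498: the excluded pair (ℚ(√−3), 3))] -/
theorem discr_ne_neg_three_of_not_three_dvd {K : Type} [Field K] [NumberField K]
    (hpD : ¬ (3 : ℤ) ∣ NumberField.discr K) : NumberField.discr K ≠ -3 := by
  intro h
  exact hpD ⟨-1, by rw [h]; norm_num⟩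

section ClassFree

variable (W : WeierstrassCurve ℚ) [W.IsElliptic] (p : ℕ) [Fact p.Prime]

/-- **`BSD(E,p)` from the Heegner-index certificate in the Cha route's OWN binder shape, Cha-free.**
For `E/ℚ` of analytic rank `≤ 1`, an imaginary quadratic `K` with the Heegner hypothesis for the
level `N`, a Heegner point `P = y_K` of infinite order, an odd prime `p` with `p ∤ d_K` and `E[p]`
irreducible (NOT necessarily surjective), `p ∤ [E(K) : ℤ P]` and `#Ш_an = q` with `ord_p q = 0`:
`BSD(E,p)` — from Matar–Nekovář 2019 Thm. 6.7 (1) (`hMN`) and Gross–Zagier–Kolyvagin (`hGZK`)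
through `Typed.bsdp_of_matarNekovar_of_not_dvd_index`; the binder `p ∤ d_K` is used only at
`p = 3`, to exclude `K = ℚ(√−3)`. Compared with `Typed.bsdp_of_cha_of_not_dvd_index` the binders
`¬ W.HasCM` and `¬ p² ∣ N` are GONE and `hMN` replaces `hCha`. Per pair; not a class theorem.
[cite: MatarNekovar2019, Thm. 6.7 (1) (p. 498) and §6.6 (Cha 2005 Thm. 21 reproved for m = 0)]
[cite: Miller2011LMS, Thm. 5.2 and Def. 1.1 (the Cha route being replaced)] -/
theorem bsdp_of_matarNekovar_of_not_dvd_discr_of_not_dvd_index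
    (hGZK : rank_eq_analyticRank_of_analyticRank_le_one)
    {N : ℕ} [NeZero N] {K : Type} [Field K] [NumberField K]
    (hMN : MatarNekovar2019.thm67_sha_primary_trivial_of_irreducible N W K)
    (hK : IsImaginaryQuadratic K) (hH : SatisfiesHeegnerHypothesis N K)
    {P : (W.baseChange K).toAffine.Point} (hP : IsHeegnerPoint N W K P) (hnt : ¬ IsOfFinAddOrder P)
    (hp2 : p ≠ 2) (hpD : ¬ (p : ℤ) ∣ NumberField.discr K) (hirr : Irr W p)
    (hI : ¬ p ∣ (AddSubgroup.zmultiples P).index)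
    (hr : W.analyticRank ≤ 1) {q : ℚ} (hq : shaAn W = (q : ℂ)) (hv : padicValRat p q = 0) :
    BSDp W p := by
  refine Typed.bsdp_of_matarNekovar_of_not_dvd_index W p hGZK hMN hK hH hP hnt hp2 hirr ?_ hI hr hq hv
  rintro rfl
  exact discr_ne_neg_three_of_not_three_dvd (by exact_mod_cast hpD)

/-- **`Ш(E/ℚ)[p] = 0` in the same Cha-free shape** (the certificate conclusion feeding `BSD(E,p)`):
odd `p` with `p ∤ d_K`, `E[p]` irreducible, Heegner field / point, `p ∤ [E(K) : ℤ P]`; from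
Matar–Nekovář Thm. 6.7 (1) (`hMN`). [cite: MatarNekovar2019, Thm. 6.7 (1) (p. 498)] -/
theorem noPTorsion_of_matarNekovar_of_not_dvd_discr_of_not_dvd_index
    {N : ℕ} [NeZero N] {K : Type} [Field K] [NumberField K]
    (hMN : MatarNekovar2019.thm67_sha_primary_trivial_of_irreducible N W K)
    (hK : IsImaginaryQuadratic K) (hH : SatisfiesHeegnerHypothesis N K)
    {P : (W.baseChange K).toAffine.Point} (hP : IsHeegnerPoint N W K P) (hnt : ¬ IsOfFinAddOrder P)
    (hp2 : p ≠ 2) (hpD : ¬ (p : ℤ) ∣ NumberField.discr K) (hirr : Irr W p)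
    (hI : ¬ p ∣ (AddSubgroup.zmultiples P).index) : ∀ x : W.sha, (p : ℤ) • x = 0 → x = 0 := by
  refine Typed.noPTorsion_of_matarNekovar_of_not_dvd_index W p hMN hK hH hP hnt hp2 hirr ?_ hI
  rintro rfl
  exact discr_ne_neg_three_of_not_three_dvd (by exact_mod_cast hpD)

end ClassFree

/-! ### Class X9 (`p ≥ 5` good ordinary, `E[p]` irreducible, `ρ̄_{E,p}` not surjective) -/

section X9

variable (W : WeierstrassCurve ℚ) [W.IsElliptic] [W.IsGloballyMinimal] (p : ℕ) [Fact p.Prime]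

/-- **X9, either rank, `p ∤ #Ш_an`: `BSD(E,p)` from Matar–Nekovář 2019 Thm. 6.7 (1) and the
Heegner-index certificate — no Cha 2005, no `p ∤ d_K`, no `p² ∤ N`.** On `ClassX9 W p` the image
hypothesis of the fact (`E[p]` irreducible) and `p ≠ 2` come from the class (`Irr W p`, `5 ≤ p`),
and the proviso `(K, p) ≠ (ℚ(√−3), 3)` is vacuous (`p ≥ 5`). What remains per pair is the finite
certificate: a Heegner field `K` for the level `N` (ANY, `p ∣ d_K` allowed), a Heegner point
`P = y_K` of infinite order with `p ∤ [E(K) : ℤ P]`, and `#Ш_an = q` with `ord_p q = 0`. Same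
certificate as `X9.bsdp_of_cha_of_not_dvd_index`, binders `hpD`, `hpN` dropped, `hMN` for `hCha`.
NOT a class theorem; X9's label is unchanged. [cite: MatarNekovar2019, Thm. 6.7 (1) (p. 498)]
[cite: Miller2011LMS, §1 and Def. 1.1] -/
theorem X9.bsdp_of_matarNekovar_of_not_dvd_index
    (hGZK : rank_eq_analyticRank_of_analyticRank_le_one)
    {N : ℕ} [NeZero N] {K : Type} [Field K] [NumberField K]
    (hMN : MatarNekovar2019.thm67_sha_primary_trivial_of_irreducible N W K) (hX : ClassX9 W p)
    (hK : IsImaginaryQuadratic K) (hH : SatisfiesHeegnerHypothesis N K)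
    {P : (W.baseChange K).toAffine.Point} (hP : IsHeegnerPoint N W K P) (hnt : ¬ IsOfFinAddOrder P)
    (hI : ¬ p ∣ (AddSubgroup.zmultiples P).index)
    (hr : W.analyticRank ≤ 1) {q : ℚ} (hq : shaAn W = (q : ℂ)) (hv : padicValRat p q = 0) :
    BSDp W p := by
  obtain ⟨-, -, hp5, hirr, -, -⟩ := hX
  exact Typed.bsdp_of_matarNekovar_of_not_dvd_index W p hGZK hMN hK hH hP hnt (by omega) hirr
    (fun h3 ↦ by omega) hI hr hq hv

/-- **X9, the divisibility form of the certificate** (`y_K ∉ pE(K)` in place of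
`P` non-torsion and `p ∤ [E(K) : ℤ P]`, exactly as Thm. 6.7 (1) prints it).
[cite: MatarNekovar2019, Thm. 6.7 (1) (p. 498)] [cite: Miller2011LMS, §1 and Def. 1.1] -/
theorem X9.bsdp_of_matarNekovar_of_not_pdiv
    (hGZK : rank_eq_analyticRank_of_analyticRank_le_one)
    {N : ℕ} [NeZero N] {K : Type} [Field K] [NumberField K]
    (hMN : MatarNekovar2019.thm67_sha_primary_trivial_of_irreducible N W K) (hX : ClassX9 W p)
    (hK : IsImaginaryQuadratic K) (hH : SatisfiesHeegnerHypothesis N K)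
    {P : (W.baseChange K).toAffine.Point} (hP : IsHeegnerPoint N W K P)
    (hdiv : ¬ ∃ Q : (W.baseChange K).toAffine.Point, p • Q = P)
    (hr : W.analyticRank ≤ 1) {q : ℚ} (hq : shaAn W = (q : ℂ)) (hv : padicValRat p q = 0) :
    BSDp W p := by
  obtain ⟨-, -, hp5, hirr, -, -⟩ := hX
  exact Typed.bsdp_of_matarNekovar_of_not_pdiv W p hGZK hMN hK hH hP (by omega) hirr
    (fun h3 ↦ by omega) hdiv hr hq hv

/-- **X9: the typed missing input of `Typed/X9.lean` is DISCHARGED, pair by pair, by the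
Matar–Nekovář certificate** (for `p ∤ #Ш_an`): `X9.MissingInputAt W p` (= `MissingPPartAt W p`)
holds at every X9 pair carrying the certificate. Bookkeeping only; the class stays typed.
[cite: MatarNekovar2019, Thm. 6.7 (1) (p. 498)] [cite: Miller2011LMS, Def. 1.1] -/
theorem X9.missingInputAt_of_matarNekovar_of_not_dvd_index
    (hGZK : rank_eq_analyticRank_of_analyticRank_le_one)
    {N : ℕ} [NeZero N] {K : Type} [Field K] [NumberField K]
    (hMN : MatarNekovar2019.thm67_sha_primary_trivial_of_irreducible N W K) (hX : ClassX9 W p)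
    (hK : IsImaginaryQuadratic K) (hH : SatisfiesHeegnerHypothesis N K)
    {P : (W.baseChange K).toAffine.Point} (hP : IsHeegnerPoint N W K P) (hnt : ¬ IsOfFinAddOrder P)
    (hI : ¬ p ∣ (AddSubgroup.zmultiples P).index)
    (hr : W.analyticRank ≤ 1) {q : ℚ} (hq : shaAn W = (q : ℂ)) (hv : padicValRat p q = 0) :
    X9.MissingInputAt W p := by
  obtain ⟨-, -, hp5, hirr, -, -⟩ := hX
  exact missingPPartAt_of_shaAn_unit_of_noPTorsion W p (hGZK W hr).2 hq hv
    (Typed.noPTorsion_of_matarNekovar_of_not_dvd_index W p hMN hK hH hP hnt (by omega) hirr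
      (fun h3 ↦ by omega) hI)

end X9

/-! ### Class X10b (`p = 3` good ordinary, `E[3]` irreducible, `ρ̄_{E,3}` not surjective) -/

section X10b

variable (W : WeierstrassCurve ℚ) [W.IsElliptic] [W.IsGloballyMinimal]

/-- **X10b (`ClassX10 W 3`, with or without `Surj W 3`), either rank, `3 ∤ #Ш_an`: `BSD(E,3)` from
Matar–Nekovář 2019 Thm. 6.7 (1) and the Heegner-index certificate.** `ClassX10` supplies `E[3]`
irreducible; the fact's only proviso at `p = 3` is `K ≠ ℚ(√−3)`, kept as the binder `h3 : d_K ≠ −3`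
(the Cha route's `3 ∤ d_K` implies it: `discr_ne_neg_three_of_not_three_dvd`; a Heegner field for
a level `N` with `3 ∣ N` satisfies it automatically, `3` being split). No non-CM binder, no
`9 ∤ N`. Per curve; not a class theorem; X10b keeps its label.
[cite: MatarNekovar2019, Thm. 6.7 (1) (p. 498)] [cite: Miller2011LMS, §1 and Def. 1.1] -/
theorem X10b.bsdp_of_matarNekovar_of_not_dvd_index
    (hGZK : rank_eq_analyticRank_of_analyticRank_le_one) [Fact (3 : ℕ).Prime]
    {N : ℕ} [NeZero N] {K : Type} [Field K] [NumberField K]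
    (hMN : MatarNekovar2019.thm67_sha_primary_trivial_of_irreducible N W K) (hX : ClassX10 W 3)
    (hK : IsImaginaryQuadratic K) (hH : SatisfiesHeegnerHypothesis N K)
    (h3 : NumberField.discr K ≠ -3)
    {P : (W.baseChange K).toAffine.Point} (hP : IsHeegnerPoint N W K P) (hnt : ¬ IsOfFinAddOrder P)
    (hI : ¬ 3 ∣ (AddSubgroup.zmultiples P).index)
    (hr : W.analyticRank ≤ 1) {q : ℚ} (hq : shaAn W = (q : ℂ)) (hv : padicValRat 3 q = 0) :
    BSDp W 3 := by
  obtain ⟨-, -, hirr, -⟩ := hX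
  exact Typed.bsdp_of_matarNekovar_of_not_dvd_index W 3 hGZK hMN hK hH hP hnt (by decide) hirr
    (fun _ ↦ h3) hI hr hq hv

/-- **X10b, Cha-route binder shape** (`3 ∤ d_K` instead of `d_K ≠ −3`): the same conclusion, so
that a certificate filed for `X10b.bsdp_of_cha_of_not_dvd_index` is consumed verbatim (drop its
`¬cm` and `9 ∤ N`). [cite: MatarNekovar2019, Thm. 6.7 (1) (p. 498)] [cite: Miller2011LMS, Thm. 5.2 and Def. 1.1] -/
theorem X10b.bsdp_of_matarNekovar_of_not_three_dvd_discr_of_not_dvd_index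
    (hGZK : rank_eq_analyticRank_of_analyticRank_le_one) [Fact (3 : ℕ).Prime]
    {N : ℕ} [NeZero N] {K : Type} [Field K] [NumberField K]
    (hMN : MatarNekovar2019.thm67_sha_primary_trivial_of_irreducible N W K) (hX : ClassX10 W 3)
    (hK : IsImaginaryQuadratic K) (hH : SatisfiesHeegnerHypothesis N K)
    (hpD : ¬ (3 : ℤ) ∣ NumberField.discr K)
    {P : (W.baseChange K).toAffine.Point} (hP : IsHeegnerPoint N W K P) (hnt : ¬ IsOfFinAddOrder P)
    (hI : ¬ 3 ∣ (AddSubgroup.zmultiples P).index)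
    (hr : W.analyticRank ≤ 1) {q : ℚ} (hq : shaAn W = (q : ℂ)) (hv : padicValRat 3 q = 0) :
    BSDp W 3 :=
  X10b.bsdp_of_matarNekovar_of_not_dvd_index W hGZK hMN hX hK hH
    (discr_ne_neg_three_of_not_three_dvd hpD) hP hnt hI hr hq hv

/-- **X10b: the typed missing input `X10b.MissingInputAt W` (= `MissingPPartAt W 3`) is
DISCHARGED at every pair carrying the Matar–Nekovář certificate** (`3 ∤ #Ш_an`). Bookkeeping only.
[cite: MatarNekovar2019, Thm. 6.7 (1) (p. 498)] [cite: Miller2011LMS, Def. 1.1] -/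
theorem X10b.missingInputAt_of_matarNekovar_of_not_dvd_index
    (hGZK : rank_eq_analyticRank_of_analyticRank_le_one) [Fact (3 : ℕ).Prime]
    {N : ℕ} [NeZero N] {K : Type} [Field K] [NumberField K]
    (hMN : MatarNekovar2019.thm67_sha_primary_trivial_of_irreducible N W K) (hX : ClassX10 W 3)
    (hK : IsImaginaryQuadratic K) (hH : SatisfiesHeegnerHypothesis N K)
    (h3 : NumberField.discr K ≠ -3)
    {P : (W.baseChange K).toAffine.Point} (hP : IsHeegnerPoint N W K P) (hnt : ¬ IsOfFinAddOrder P)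
    (hI : ¬ 3 ∣ (AddSubgroup.zmultiples P).index)
    (hr : W.analyticRank ≤ 1) {q : ℚ} (hq : shaAn W = (q : ℂ)) (hv : padicValRat 3 q = 0) :
    X10b.MissingInputAt W := by
  obtain ⟨-, -, hirr, -⟩ := hX
  exact missingPPartAt_of_shaAn_unit_of_noPTorsion W 3 (hGZK W hr).2 hq hv
    (Typed.noPTorsion_of_matarNekovar_of_not_dvd_index W 3 hMN hK hH hP hnt (by decide) hirr
      (fun _ ↦ h3) hI)

end X10b

end Literature.NumberTheory.EllipticCurves.Rank1Residual.Typed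

end
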